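import Summits.Ventures.PercRepro.RankLevelSetRuleQSliceFirstUntrunc

/-!
# PercRepro — THE CONTRACTION CHAIN FOR THE CELL `m = 3` OF EVERY SLICE; A BOTTOM-REGIME CRITERION (night-1, gen 21; dossier §32.3)

The chains of RankLevelSetRuleQSliceTailThree (`u = k − 2`) and RankLevelSetRuleQSliceFirstUntrunc (`u = k − 1`) are one chain
with the slice `u` free. With `q = u + 3`, `T_u(3) = sliceTail u k 3 = Σ_{i ≤ u} sliceThreeTerm u k i`,
`sliceThreeTerm u k i = C(u+k, k+i)·Σ_{a ≤ 3} C(3, a)/C(3+u+(k+i)+a, a+(k+i))`: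
* **`sliceThreeTerm_succ_le`** — the terms contract by `P₀(u, k) = u(k+4)/((k+1)(u+k+7))` (termwise in `a ≤ 3`: the `a`-factor
  `(k+i+a+1)/(u+k+4+i+a) ≤ (k+i+4)/(u+k+7+i)`, and `P(i) = (u−i)(k+i+4)/((k+i+1)(u+k+7+i)) ≤ P(0)`);
* **`sliceThreeTerm_zero_eq`** — `sliceThreeTerm u k 0 = (u+1)(u+2)(u+3)/((u+k+1)(u+k+2)(u+k+3)) · [1 + 3x₁ + 3x₁x₂ + x₁x₂x₃]`,
  `x_b = (k+b)/(u+k+3+b)`;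
* **`sliceTail_three_le_chain`** — `P₀ < 1 ⇒ sliceTail u k 3 ≤ sliceThreeTerm u k 0 / (1 − P₀)`;
* **`slice_bottom_of_three_le_one`** — THE CRITERION: `k ≥ 1`, the density condition `m·k ≤ m·u + u² + u`, `3 ≤ m`,
  `m + u + 1 ≤ k(k+1)` and `sliceTail u k 3 ≤ 1` ⇒ `Φ(q+k, q) ≤ R̂(q, k, m)` (`q = m + u`) — the cell `m = 3` decides the whole
  bottom regime of the slice (the tail decreases in `m`, the density comparison gives slack `≥ 1`).
Numerically the chain is `< 1` for `u = k − 2` (every `k`), `u = k − 1` (every `k`), `u = k` (`k ≥ 8`), `u = k + 1` (`k ≥ 15`),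
`u = k + 2` (`k ≥ 30`), and the true `T_u(3) < 1` for `u ≤ k` (every `k`), `u = k + 1` (`k ≥ 7`), `u = k + 2` (`k ≥ 13`)
(mining/night-1/g21/threechain.py). Axioms: standard.
-/

namespace PercRepro

open Finset

/-- The `i`-th term of `T_u(3) = sliceTail u k 3` (`j = k + i`, `q = u + 3`). -/
def sliceThreeTerm (u k i : ℕ) : ℚ :=
  ((u + k).choose (k + i) : ℚ)
    * ∑ a ∈ range (3 + 1), ((3 : ℕ).choose a : ℚ) / ((3 + u + (k + i) + a).choose (a + (k + i)) : ℚ)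

/-- `sliceTail u k 3 = Σ_{i ≤ u} sliceThreeTerm u k i`. -/
lemma sliceTail_three_eq (u k : ℕ) : sliceTail u k 3 = ∑ i ∈ range (u + 1), sliceThreeTerm u k i := by
  unfold sliceTail sliceThreeTerm
  have h : Finset.Icc k (u + k) = Finset.Ico k (u + k + 1) := by
    ext j; simp only [Finset.mem_Icc, Finset.mem_Ico]; omega
  rw [h, Finset.sum_Ico_eq_sum_range, show u + k + 1 - k = u + 1 by omega]

/-- The terms are nonnegative. -/
lemma sliceThreeTerm_nonneg (u k i : ℕ) : 0 ≤ sliceThreeTerm u k i := by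
  unfold sliceThreeTerm
  apply mul_nonneg (by positivity)
  apply Finset.sum_nonneg
  intro a _
  positivity

/-- The contraction ratio `P₀(u, k) = u(k+4)/((k+1)(u+k+7))`. -/
def threeRatio (u k : ℕ) : ℚ := ((u : ℚ) * ((k : ℚ) + 4)) / (((k : ℚ) + 1) * ((u : ℚ) + k + 7))

/-- `P₀ ≥ 0`. -/
lemma threeRatio_nonneg (u k : ℕ) : 0 ≤ threeRatio u k := by unfold threeRatio; positivity

/-- **The terms of `T_u(3)` contract by `P₀(u, k)`** for `i + 1 ≤ u`. -/
lemma sliceThreeTerm_succ_le (u k i : ℕ) (hi : i + 1 ≤ u) :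
    sliceThreeTerm u k (i + 1) ≤ threeRatio u k * sliceThreeTerm u k i := by
  unfold sliceThreeTerm
  rw [Finset.mul_sum, Finset.mul_sum, Finset.mul_sum]
  apply Finset.sum_le_sum
  intro a ha
  rw [Finset.mem_range] at ha
  rw [show k + (i + 1) = k + i + 1 by ring,
    show 3 + u + (k + i + 1) + a = 3 + u + (k + i) + a + 1 by ring,
    show a + (k + i + 1) = a + (k + i) + 1 by ring]
  have h1 := Nat.choose_succ_right_eq (u + k) (k + i)
  rw [show u + k - (k + i) = u - i by omega] at h1
  have hc1 := congrArg (fun x : ℕ => (x : ℚ)) h1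
  push_cast [Nat.cast_sub (by omega : i ≤ u)] at hc1
  have h2 := Nat.add_one_mul_choose_eq (3 + u + (k + i) + a) (a + (k + i))
  have hc2 := congrArg (fun x : ℕ => (x : ℚ)) h2
  push_cast at hc2
  have hB : (0 : ℚ) < ((3 + u + (k + i) + a).choose (a + (k + i)) : ℚ) :=
    Nat.cast_pos.mpr (Nat.choose_pos (by omega))
  have hB' : (0 : ℚ) < ((3 + u + (k + i) + a + 1).choose (a + (k + i) + 1) : ℚ) :=
    Nat.cast_pos.mpr (Nat.choose_pos (by omega))
  have hiu : (i : ℚ) + 1 ≤ u := by exact_mod_cast hi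
  have ha3 : (a : ℚ) ≤ 3 := by exact_mod_cast (by omega : a ≤ 3)
  have ha0 : (0 : ℚ) ≤ a := by positivity
  have hi0 : (0 : ℚ) ≤ i := by positivity
  have hu0 : (0 : ℚ) ≤ u := by positivity
  have hk0 : (0 : ℚ) ≤ k := by positivity
  have hpos1 : (0 : ℚ) < (k : ℚ) + i + 1 := by positivity
  have e1 : ((u + k).choose (k + i + 1) : ℚ) = ((u + k).choose (k + i) : ℚ) * (((u : ℚ) - i) / ((k : ℚ) + i + 1)) := by
    rw [mul_div_assoc', eq_div_iff hpos1.ne']; linarith [hc1]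
  have e2 : (1 : ℚ) / ((3 + u + (k + i) + a + 1).choose (a + (k + i) + 1) : ℚ)
      = ((((a + (k + i) : ℕ) : ℚ) + 1) / (((3 + u + (k + i) + a : ℕ) : ℚ) + 1))
          * (1 / ((3 + u + (k + i) + a).choose (a + (k + i)) : ℚ)) := by
    rw [div_mul_div_comm, mul_one, div_eq_div_iff hB'.ne' (mul_pos (by positivity) hB).ne']
    push_cast
    linarith [hc2]
  have hr : (((u : ℚ) - i) / ((k : ℚ) + i + 1))
      * ((((a + (k + i) : ℕ) : ℚ) + 1) / (((3 + u + (k + i) + a : ℕ) : ℚ) + 1)) ≤ threeRatio u k := by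
    push_cast
    -- the a-factor: (k+i+a+1)/(u+k+4+i+a) ≤ (k+i+4)/(u+k+7+i)
    have hA : ((a : ℚ) + (k + i) + 1) / (3 + (u : ℚ) + (k + i) + a + 1) ≤ ((k : ℚ) + i + 4) / ((u : ℚ) + k + 7 + i) := by
      rw [div_le_div_iff₀ (by positivity) (by positivity)]
      nlinarith [mul_nonneg (by linarith : (0 : ℚ) ≤ 3 - a) (by positivity : (0 : ℚ) ≤ (u : ℚ) + 3)]
    -- P(i) ≤ P(0)
    have hP : (((u : ℚ) - i) / ((k : ℚ) + i + 1)) * (((k : ℚ) + i + 4) / ((u : ℚ) + k + 7 + i)) ≤ threeRatio u k := by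
      unfold threeRatio
      rw [div_mul_div_comm, div_le_div_iff₀ (by positivity) (by positivity)]
      have key : (u : ℚ) * (k + 4) * ((k + i + 1) * (u + k + 7 + i)) - ((u : ℚ) - i) * (k + i + 4) * ((k + 1) * (u + k + 7))
          = (i : ℚ) * (3 * u ^ 2 + u * (2 * k ^ 2 + 13 * k + 29) + (k + 1) * (k + 4) * (k + 7))
            + (i : ℚ) ^ 2 * (u * (k + 4) + (k + 1) * (u + k + 7)) := by ring
      have : (0 : ℚ) ≤ (i : ℚ) * (3 * u ^ 2 + u * (2 * k ^ 2 + 13 * k + 29) + (k + 1) * (k + 4) * (k + 7))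
            + (i : ℚ) ^ 2 * (u * (k + 4) + (k + 1) * (u + k + 7)) := by positivity
      linarith
    have hui : (0 : ℚ) ≤ ((u : ℚ) - i) / ((k : ℚ) + i + 1) := by
      apply div_nonneg _ (by positivity); linarith
    calc (((u : ℚ) - i) / ((k : ℚ) + i + 1)) * (((a : ℚ) + (k + i) + 1) / (3 + (u : ℚ) + (k + i) + a + 1))
        ≤ (((u : ℚ) - i) / ((k : ℚ) + i + 1)) * (((k : ℚ) + i + 4) / ((u : ℚ) + k + 7 + i)) :=
          mul_le_mul_of_nonneg_left hA hui
      _ ≤ threeRatio u k := hP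
  rw [div_eq_mul_one_div (((3 : ℕ).choose a : ℚ)), div_eq_mul_one_div (((3 : ℕ).choose a : ℚ)), e1, e2]
  calc ((u + k).choose (k + i) : ℚ) * (((u : ℚ) - i) / ((k : ℚ) + i + 1))
        * (((3 : ℕ).choose a : ℚ) * (((((a + (k + i) : ℕ) : ℚ) + 1) / (((3 + u + (k + i) + a : ℕ) : ℚ) + 1))
          * (1 / ((3 + u + (k + i) + a).choose (a + (k + i)) : ℚ))))
      = (((u + k).choose (k + i) : ℚ) * (((3 : ℕ).choose a : ℚ)
          * (1 / ((3 + u + (k + i) + a).choose (a + (k + i)) : ℚ))))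
        * ((((u : ℚ) - i) / ((k : ℚ) + i + 1))
          * ((((a + (k + i) : ℕ) : ℚ) + 1) / (((3 + u + (k + i) + a : ℕ) : ℚ) + 1))) := by ring
    _ ≤ (((u + k).choose (k + i) : ℚ) * (((3 : ℕ).choose a : ℚ)
          * (1 / ((3 + u + (k + i) + a).choose (a + (k + i)) : ℚ)))) * threeRatio u k :=
        mul_le_mul_of_nonneg_left hr (by positivity)
    _ = _ := by ring

/-- `sliceThreeTerm u k i ≤ sliceThreeTerm u k 0 · P₀^i` for `i ≤ u`. -/
lemma sliceThreeTerm_le_geom (u k : ℕ) : ∀ i : ℕ, i ≤ u → sliceThreeTerm u k i ≤ sliceThreeTerm u k 0 * threeRatio u k ^ i := by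
  intro i
  induction i with
  | zero => intro _; simp
  | succ i ih =>
    intro hi
    calc sliceThreeTerm u k (i + 1) ≤ threeRatio u k * sliceThreeTerm u k i := sliceThreeTerm_succ_le u k i hi
      _ ≤ threeRatio u k * (sliceThreeTerm u k 0 * threeRatio u k ^ i) :=
          mul_le_mul_of_nonneg_left (ih (by omega)) (threeRatio_nonneg u k)
      _ = sliceThreeTerm u k 0 * threeRatio u k ^ (i + 1) := by ring

/-- **The first term of `T_u(3)` exactly**:
`sliceThreeTerm u k 0 = (u+1)(u+2)(u+3)/((u+k+1)(u+k+2)(u+k+3)) · (1 + 3x₁ + 3x₁x₂ + x₁x₂x₃)`, `x_b = (k+b)/(u+k+3+b)`. -/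
lemma sliceThreeTerm_zero_eq (u k : ℕ) :
    sliceThreeTerm u k 0
      = (((u : ℚ) + 1) * ((u : ℚ) + 2) * ((u : ℚ) + 3)) / (((u : ℚ) + k + 1) * ((u : ℚ) + k + 2) * ((u : ℚ) + k + 3))
        * (1 + 3 * (((k : ℚ) + 1) / ((u : ℚ) + k + 4)) + 3 * (((k : ℚ) + 1) / ((u : ℚ) + k + 4)) * (((k : ℚ) + 2) / ((u : ℚ) + k + 5))
          + (((k : ℚ) + 1) / ((u : ℚ) + k + 4)) * (((k : ℚ) + 2) / ((u : ℚ) + k + 5)) * (((k : ℚ) + 3) / ((u : ℚ) + k + 6))) := by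
  unfold sliceThreeTerm
  have c32 : (3 : ℕ).choose 2 = 3 := by decide
  simp only [Finset.sum_range_succ, Finset.sum_range_zero, Nat.add_zero, zero_add]
  rw [show 3 + u + k = u + k + 3 by ring, show u + k + 3 + 1 = u + k + 4 by ring,
    show u + k + 3 + 2 = u + k + 5 by ring, show u + k + 3 + 3 = u + k + 6 by ring,
    show 1 + k = k + 1 by ring, show 2 + k = k + 2 by ring, show 3 + k = k + 3 by ring]
  simp only [Nat.choose_zero_right, Nat.choose_one_right, Nat.choose_self, c32, Nat.cast_one, Nat.cast_ofNat]
  -- C(u+k, k)/C(u+k+3, k) = (u+1)(u+2)(u+3)/((u+k+1)(u+k+2)(u+k+3))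
  have r1 := Nat.choose_mul_succ_eq (u + k) k
  have r2 := Nat.choose_mul_succ_eq (u + k + 1) k
  have r3 := Nat.choose_mul_succ_eq (u + k + 2) k
  rw [show u + k + 1 - k = u + 1 by omega] at r1
  rw [show u + k + 1 + 1 - k = u + 2 by omega, show u + k + 1 + 1 = u + k + 2 by ring] at r2
  rw [show u + k + 2 + 1 - k = u + 3 by omega, show u + k + 2 + 1 = u + k + 3 by ring] at r3
  have s1 := Nat.add_one_mul_choose_eq (u + k + 3) k
  have s2 := Nat.add_one_mul_choose_eq (u + k + 4) (k + 1)
  have s3 := Nat.add_one_mul_choose_eq (u + k + 5) (k + 2)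
  rw [show u + k + 3 + 1 = u + k + 4 by ring] at s1
  rw [show u + k + 4 + 1 = u + k + 5 by ring, show k + 1 + 1 = k + 2 by ring] at s2
  rw [show u + k + 5 + 1 = u + k + 6 by ring, show k + 2 + 1 = k + 3 by ring] at s3
  have c1 := congrArg (fun x : ℕ => (x : ℚ)) r1
  have c2 := congrArg (fun x : ℕ => (x : ℚ)) r2
  have c3 := congrArg (fun x : ℕ => (x : ℚ)) r3
  have d1 := congrArg (fun x : ℕ => (x : ℚ)) s1
  have d2 := congrArg (fun x : ℕ => (x : ℚ)) s2
  have d3 := congrArg (fun x : ℕ => (x : ℚ)) s3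
  push_cast at c1 c2 c3 d1 d2 d3
  clear r1 r2 r3 s1 s2 s3
  have hB0 : (0 : ℚ) < ((u + k + 3).choose k : ℚ) := Nat.cast_pos.mpr (Nat.choose_pos (by omega))
  have hB1 : (0 : ℚ) < ((u + k + 4).choose (k + 1) : ℚ) := Nat.cast_pos.mpr (Nat.choose_pos (by omega))
  have hB2 : (0 : ℚ) < ((u + k + 5).choose (k + 2) : ℚ) := Nat.cast_pos.mpr (Nat.choose_pos (by omega))
  have hB3 : (0 : ℚ) < ((u + k + 6).choose (k + 3) : ℚ) := Nat.cast_pos.mpr (Nat.choose_pos (by omega))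
  have hu : (0 : ℚ) ≤ u := by positivity
  have hk : (0 : ℚ) ≤ k := by positivity
  have hu1 : (0 : ℚ) < (u : ℚ) + 1 := by positivity
  have hu2 : (0 : ℚ) < (u : ℚ) + 2 := by positivity
  have hu3 : (0 : ℚ) < (u : ℚ) + 3 := by positivity
  have hk1 : (0 : ℚ) < (k : ℚ) + 1 := by positivity
  have hk2 : (0 : ℚ) < (k : ℚ) + 2 := by positivity
  have hk3 : (0 : ℚ) < (k : ℚ) + 3 := by positivity
  set A : ℚ := ((u + k).choose k : ℚ) with hAdef
  set B₀ : ℚ := ((u + k + 3).choose k : ℚ) with hB0def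
  set B₁ : ℚ := ((u + k + 4).choose (k + 1) : ℚ) with hB1def
  set B₂ : ℚ := ((u + k + 5).choose (k + 2) : ℚ) with hB2def
  set B₃ : ℚ := ((u + k + 6).choose (k + 3) : ℚ) with hB3def
  -- A · (u+k+1)(u+k+2)(u+k+3) = B₀ · (u+1)(u+2)(u+3)
  have eA : A * (((u : ℚ) + k + 1) * ((u : ℚ) + k + 2) * ((u : ℚ) + k + 3)) = B₀ * (((u : ℚ) + 1) * ((u : ℚ) + 2) * ((u : ℚ) + 3)) := by
    linear_combination (((u : ℚ) + k + 2) * ((u : ℚ) + k + 3)) * c1 + (((u : ℚ) + 1) * ((u : ℚ) + k + 3)) * c2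
      + (((u : ℚ) + 1) * ((u : ℚ) + 2)) * c3
  have eB1 : B₁ = (((u : ℚ) + k + 4) / ((k : ℚ) + 1)) * B₀ := by
    rw [div_mul_eq_mul_div, eq_div_iff hk1.ne']; linear_combination -d1
  have eB2 : B₂ = (((u : ℚ) + k + 5) / ((k : ℚ) + 2)) * B₁ := by
    rw [div_mul_eq_mul_div, eq_div_iff hk2.ne']; linear_combination -d2
  have eB3 : B₃ = (((u : ℚ) + k + 6) / ((k : ℚ) + 3)) * B₂ := by
    rw [div_mul_eq_mul_div, eq_div_iff hk3.ne']; linear_combination -d3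
  have eA' : A = B₀ * (((u : ℚ) + 1) * ((u : ℚ) + 2) * ((u : ℚ) + 3)) / (((u : ℚ) + k + 1) * ((u : ℚ) + k + 2) * ((u : ℚ) + k + 3)) := by
    rw [eq_div_iff (by positivity)]; exact eA
  rw [eB3, eB2, eB1, eA']
  have hB0' : B₀ ≠ 0 := hB0.ne'
  have h1 : (u : ℚ) + k + 1 ≠ 0 := by positivity
  have h2 : (u : ℚ) + k + 2 ≠ 0 := by positivity
  have h3 : (u : ℚ) + k + 3 ≠ 0 := by positivity
  have h4 : (u : ℚ) + k + 4 ≠ 0 := by positivity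
  have h5 : (u : ℚ) + k + 5 ≠ 0 := by positivity
  have h6 : (u : ℚ) + k + 6 ≠ 0 := by positivity
  field_simp

/-- **The chain**: `P₀(u, k) < 1 ⇒ sliceTail u k 3 ≤ sliceThreeTerm u k 0 / (1 − P₀(u, k))`. -/
theorem sliceTail_three_le_chain (u k : ℕ) (h : threeRatio u k < 1) :
    sliceTail u k 3 ≤ sliceThreeTerm u k 0 * (1 / (1 - threeRatio u k)) := by
  rw [sliceTail_three_eq]
  have h0 := sliceThreeTerm_nonneg u k 0
  calc ∑ i ∈ range (u + 1), sliceThreeTerm u k i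
      ≤ ∑ i ∈ range (u + 1), sliceThreeTerm u k 0 * threeRatio u k ^ i := by
        apply Finset.sum_le_sum
        intro i hi
        rw [Finset.mem_range] at hi
        exact sliceThreeTerm_le_geom u k i (by omega)
    _ = sliceThreeTerm u k 0 * ∑ i ∈ range (u + 1), threeRatio u k ^ i := by rw [Finset.mul_sum]
    _ ≤ sliceThreeTerm u k 0 * (1 / (1 - threeRatio u k)) :=
        mul_le_mul_of_nonneg_left (sum_geom_le_inv (threeRatio u k) (threeRatio_nonneg u k) h (u + 1)) h0

/-- `T_u(m) ≤ T_u(3)` for `3 ≤ m` with `m + u ≤ k(k+1)` (the descent of `sliceTail_succ_le_self`). -/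
lemma sliceTail_le_three_of (u k m : ℕ) (h3 : 3 ≤ m) (hm : m + u ≤ k * (k + 1)) :
    sliceTail u k m ≤ sliceTail u k 3 := by
  obtain ⟨d, rfl⟩ : ∃ d, m = 3 + d := ⟨m - 3, by omega⟩
  induction d with
  | zero => simp
  | succ d ih =>
    calc sliceTail u k (3 + (d + 1)) = sliceTail u k (3 + d + 1) := by rw [Nat.add_assoc]
      _ ≤ sliceTail u k (3 + d) := sliceTail_succ_le_self u k (3 + d) (by omega)
      _ ≤ sliceTail u k 3 := ih (by omega) (by omega)

/-- **THE BOTTOM-REGIME CRITERION OF A SLICE**: `k ≥ 1`, `m·k ≤ m·u + u² + u` (the density condition), `3 ≤ m`,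
`m + u ≤ k(k+1)` and `sliceTail u k 3 ≤ 1` ⇒ `Φ(q+k, q) ≤ R̂(q, k, m)` (`q = m + u`). -/
theorem slice_bottom_of_three_le_one (u k m : ℕ) (hk : 1 ≤ k) (hd : m * k ≤ m * u + u * u + u) (h3 : 3 ≤ m)
    (hm : m + u ≤ k * (k + 1)) (hT : sliceTail u k 3 ≤ 1) :
    phiK (m + u + k) (m + u) ≤ rhat (m + u) k m :=
  phiK_le_rhat_of_sliceTail_le_one u k m hk hd ((sliceTail_le_three_of u k m h3 hm).trans hT)

end PercRepro
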